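import Literature.Geometry.Lorentzian.KerrObstructionLinearPart
import Literature.Geometry.Lorentzian.KerrCylinderFamilyContinuity
import HarnessLib

/-!
# The linear part of Li–Mei's obstruction, packaged for the degree step

Support file (all results proved; no named facts) for the named fact `LiMei.interiorKerrGluing`
(`InteriorKerrGluing.lean`; J. Li, H. Mei, *A construction of collapsing spacetimes in vacuum*,
Comm. Math. Phys. 378 (2020) = arXiv:2005.01249, Prop. 4.1), Step S5 of the architecture recorded
in `InteriorKerrGluingReduction.lean`. The reduction `LiMei.interiorKerrGluing_of_core` asks for
the obstruction in the form `𝓘(p) = L p + e + Q(p)` with `‖e‖ ≤ C₁ε`, `Q` continuous and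
`‖Q(p)‖ ≤ C₂ε²` on a ball `‖p‖ ≤ C₀ε` (Li–Mei p. 25). This file delivers exactly this shape for the
LINEAR part `𝓛_X(γ, κ) = ∫ √g₀ χ DM_{(G₀,K₀)}(γ, κ)(X) dy` of the obstruction, evaluated on the
deformed glued datum `D̃(p) + (h, ω)` for ANY correction `(h, ω)` supported in the plateau
`{t₁ < ‖y‖ < t₂}` of the shell cut-off `χ = shellProfile s₁ t₁ t₂ s₂ ∘ ‖·‖` (where the
Corvino–Schoen correction of Step S3 lives):

* `LiMei.timeIntegrandWith_add_of_plateau`, `LiMei.norm_le_or_le_of_deriv_shellProfile_ne_zero` —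
  plateau-supported corrections do not change the linearised-obstruction integrands;
* `LiMei.exists_linearObstruction_time_package` — there are `δ > 0`, `C₁, C₂ ≥ 0` such that for
  every datum `D` `ε`-close to the Schwarzschild cylinder there are a constant `e₀` with
  **`|e₀| ≤ C₁ ε`** and a function `q₀` **continuous** on the box `{|δm| + ‖b‖ < δ}` with
  **`|q₀(p)| ≤ C₂ (|δm| + ‖b‖)²**, such that for all `p` in the box, all admissible parameter
  proofs and all smooth symmetric plateau-supported `(h, ω)`,
  **`𝓛_{∂_t}(D̃(p) + (h, ω) − (G₀, K₀)) = 8π δm + e₀ + q₀(p)`**;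
* `LiMei.exists_linearObstruction_rot_package` — the same for `Ω_ξ` (`‖ξ‖ ≤ 1`) with
  `−8πM⟨b, ξ⟩`.

What the prover of the analytic core still has to add is the NONLINEAR remainder
`𝓘_X − 𝓛_X = ∫ √g₀ χ [M(D̃(p) + (h,ω))(X) − DM_{(G₀,K₀)}(D̃(p) + (h,ω) − (G₀,K₀))(X)] = O(ε²)`
and the existence of `(h, ω)` (Step S3).

## References

* J. Li, H. Mei, arXiv:2005.01249, §4, proof of Prop. 4.1, pp. 22–25 (key `LiMei2020`).
-/

noncomputable section

open Set Filter Function Metric MeasureTheory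
open scoped Topology RealInnerProductSpace Real Manifold ContDiff

namespace Literature.Geometry.Lorentzian

namespace LiMei

open MetricCoord

attribute [local instance] instNormedAddCommGroupBilinE3 instNormedSpaceBilinE3

/-! ### Plateau-supported corrections do not contribute to the linear part -/

/-- A correction vanishing wherever `χ₀'(‖y‖) ≠ 0` does not change the `∂_t`-integrand.
[folklore] -/
theorem timeIntegrandWith_add_of_plateau (M r₀ : ℝ) (χ₀ : ℝ → ℝ)
    (βH βK γ₁ κ₁ : E3 →L[ℝ] E3 →L[ℝ] ℝ) {y : E3} (hz : deriv χ₀ ‖y‖ ≠ 0 → γ₁ = 0 ∧ κ₁ = 0) :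
    timeIntegrandWith M r₀ χ₀ (βH + γ₁) (βK + κ₁) y = timeIntegrandWith M r₀ χ₀ βH βK y := by
  by_cases hd : deriv χ₀ ‖y‖ = 0
  · rw [timeIntegrandWith_eq_zero M r₀ _ _ hd, timeIntegrandWith_eq_zero M r₀ _ _ hd]
  · obtain ⟨h0, k0⟩ := hz hd
    have e1 : βH + γ₁ = βH := by
      ext v w; rw [add_apply, add_apply, h0]; simp
    have e2 : βK + κ₁ = βK := by
      ext v w; rw [add_apply, add_apply, k0]; simp
    rw [e1, e2]

/-- A correction vanishing wherever `χ₀'(‖y‖) ≠ 0` does not change the `Ω_ξ`-integrand.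
[folklore] -/
theorem rotIntegrandWith_add_of_plateau (M r₀ : ℝ) (χ₀ : ℝ → ℝ) (ξ : E3)
    (βH βK γ₁ κ₁ : E3 →L[ℝ] E3 →L[ℝ] ℝ) {y : E3} (hz : deriv χ₀ ‖y‖ ≠ 0 → γ₁ = 0 ∧ κ₁ = 0) :
    rotIntegrandWith M r₀ χ₀ ξ (βH + γ₁) (βK + κ₁) y = rotIntegrandWith M r₀ χ₀ ξ βH βK y := by
  by_cases hd : deriv χ₀ ‖y‖ = 0
  · rw [rotIntegrandWith_eq_zero M r₀ ξ _ _ hd, rotIntegrandWith_eq_zero M r₀ ξ _ _ hd]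
  · obtain ⟨h0, k0⟩ := hz hd
    have e1 : βH + γ₁ = βH := by
      ext v w; rw [add_apply, add_apply, h0]; simp
    have e2 : βK + κ₁ = βK := by
      ext v w; rw [add_apply, add_apply, k0]; simp
    rw [e1, e2]

/-- **The derivative of the shell profile vanishes on the plateau**: if
`(shellProfile s₁ t₁ t₂ s₂)'(‖y‖) ≠ 0` then `‖y‖ ≤ t₁` or `t₂ ≤ ‖y‖` (`0 ≤ s₁ < t₁ ≤ t₂ < s₂`).
[folklore] -/
theorem norm_le_or_le_of_deriv_shellProfile_ne_zero {s₁ t₁ t₂ s₂ : ℝ} (hs₁ : 0 ≤ s₁) (h₁ : s₁ < t₁)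
    (h₁₂ : t₁ ≤ t₂) (h₂ : t₂ < s₂) {y : E3} (hd : deriv (shellProfile s₁ t₁ t₂ s₂) ‖y‖ ≠ 0) :
    ‖y‖ ≤ t₁ ∨ t₂ ≤ ‖y‖ := by
  by_contra hcon
  push Not at hcon
  obtain ⟨ht₁, ht₂⟩ := hcon
  have ht₂0 : 0 ≤ t₂ := hs₁.trans (h₁.le.trans h₁₂)
  apply hd
  rw [deriv_shellProfile hs₁ h₁ h₁₂ h₂, deriv_const_sub,
    deriv_cutoffProfile_eq_zero_of_lt_abs (radialCutoff_real_of_le_abs hs₁ h₁) (by rwa [abs_norm]),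
    deriv_cutoffProfile_eq_zero_of_abs_lt (radialCutoff_real_of_abs_le ht₂0 h₂) (by rwa [abs_norm])]
  ring

section Package

variable [Kerr.Facts]

/-! ### The `∂_t`-component -/

/-- **The linear part of the `∂_t`-obstruction, packaged for the degree step.** Radii
`1 ≤ ρ₁ < s₁ < t₁ ≤ c₁ < c₂ ≤ t₂ < s₂ < ρ₂`, `r₁ < r₀`, `0 < r₀ < 2M`, background frame `R₀`,
`χ = shellProfile s₁ t₁ t₂ s₂ ∘ ‖·‖`, `D̃(p) = preGluedDatum (M + p.1, ‖p.2‖, R_{p.2}; c₁, c₂) D`.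
There are `δ > 0`, `C₁, C₂ ≥ 0` such that for every `D` that is `ε`-close to the Schwarzschild
cylinder on `{ρ₁ < ‖y‖ < ρ₂}` there are `e₀ ∈ ℝ` with `|e₀| ≤ C₁ε` and `q₀ : ℝ × E3 → ℝ`
continuous on `{|p.1| + ‖p.2‖ < δ}` with `|q₀ p| ≤ C₂(|p.1| + ‖p.2‖)²` there, such that for all
`p` in the box, all admissibility proofs and all smooth symmetric corrections `(h, ω)` on
`{1 < ‖y‖}` vanishing off the open plateau `{t₁ < ‖y‖ < t₂}`,
`∫ √g₀ χ DM_{(G₀,K₀)}(D̃(p) + (h, ω) − (G₀, K₀))(∂_t) dy = 8π p.1 + e₀ + q₀ p`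
(Li–Mei p. 25, the linear part of `𝓘 = (8π(m − m₀), …) + (ε₀, …) + O(ε²)`).
[cite: LiMei2020, proof of Prop. 4.1, p. 25] -/
theorem exists_linearObstruction_time_package {M r₁ r₀ ρ₁ ρ₂ s₁ t₁ c₁ c₂ t₂ s₂ : ℝ} {k : ℕ}
    (hr₁ : r₁ < r₀) (hr₀ : 0 < r₀) (h2M : r₀ < 2 * M) (hρ₁ : 1 ≤ ρ₁) (hρs : ρ₁ < s₁) (hst : s₁ < t₁)
    (htc : t₁ ≤ c₁) (hc : c₁ < c₂) (hct : c₂ ≤ t₂) (hts : t₂ < s₂) (hsρ : s₂ < ρ₂) (τ₀ : ℝ)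
    (R₀ : E3 →ₗᵢ[ℝ] E3) :
    ∃ δ C₁ C₂ : ℝ, 0 < δ ∧ 0 ≤ C₁ ∧ 0 ≤ C₂ ∧ ∀ (ε : ℝ) (D : InitialDataSet (𝓡 3) E3),
      NearSchwarzschildCylinder M r₁ r₀ ρ₁ ρ₂ k ε D →
      ∃ e₀ : ℝ, |e₀| ≤ C₁ * ε ∧ ∃ q₀ : ℝ × E3 → ℝ,
        ContinuousOn q₀ {p : ℝ × E3 | |p.1| + ‖p.2‖ < δ} ∧
        (∀ p : ℝ × E3, |p.1| + ‖p.2‖ < δ → |q₀ p| ≤ C₂ * (|p.1| + ‖p.2‖) ^ 2) ∧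
        ∀ p : ℝ × E3, |p.1| + ‖p.2‖ < δ →
          ∀ (ha : |‖p.2‖| < M + p.1) (h₁ : Kerr.rMinus (M + p.1) ‖p.2‖ < r₀)
            (h₂ : r₀ < Kerr.rPlus (M + p.1) ‖p.2‖) (γ₁ κ₁ : E3 → E3 →L[ℝ] E3 →L[ℝ] ℝ),
            ContDiffOn ℝ ∞ γ₁ {y : E3 | 1 < ‖y‖} → ContDiffOn ℝ ∞ κ₁ {y : E3 | 1 < ‖y‖} →
            (∀ y v w, γ₁ y v w = γ₁ y w v) → (∀ y v w, κ₁ y v w = κ₁ y w v) →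
            (∀ y : E3, (‖y‖ ≤ t₁ ∨ t₂ ≤ ‖y‖) → γ₁ y = 0 ∧ κ₁ y = 0) →
            ∫ y, sqrtDetGram (cylH M 0 r₀ τ₀ R₀) (EuclideanSpace.basisFun (Fin 3) ℝ).toBasis y *
                (shellProfile s₁ t₁ t₂ s₂ ‖y‖ *
                  linMomFn (EuclideanSpace.basisFun (Fin 3) ℝ).toBasis (cylH M 0 r₀ τ₀ R₀)
                    (cylK M 0 hr₀ τ₀ R₀)
                    (fun z ↦ (preGluedDatum ha h₁ h₂ τ₀ (spinIsometry p.2) c₁ c₂ D).coordH z -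
                      cylH M 0 r₀ τ₀ R₀ z + γ₁ z)
                    (fun z ↦ (preGluedDatum ha h₁ h₂ τ₀ (spinIsometry p.2) c₁ c₂ D).coordK z -
                      cylK M 0 hr₀ τ₀ R₀ z + κ₁ z) y (dirVec y)) =
              8 * π * p.1 + e₀ + q₀ p := by
  have hρt₂ : ρ₁ < t₂ := by linarith
  have htρ : t₁ < ρ₂ := by linarith
  have hs₁1 : 1 < s₁ := lt_of_le_of_lt hρ₁ hρs
  have hs₁0 : 0 ≤ s₁ := zero_le_one.trans hs₁1.le
  have ht₂0 : 0 ≤ t₂ := by linarith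
  have hc₁0 : 0 ≤ c₁ := by linarith
  have ht₁₂ : t₁ ≤ t₂ := htc.trans (hc.le.trans hct)
  -- the outer layer: estimate (FILE C) and continuity (FILE G), with the outer profile
  obtain ⟨δC, C, hδC, hC, hout⟩ := exists_abs_integral_timeIntegrandWith_sub_le hr₀ h2M τ₀ R₀ hρ₁
    hρt₂ hsρ (contDiff_one_radialCutoff_real t₂ s₂) (radialCutoff_real_of_abs_le ht₂0 hts)
    (radialCutoff_real_of_le_abs ht₂0 hts)
  obtain ⟨δG, hδG, hcont⟩ := exists_continuousOn_integral_timeIntegrandWith_family (M := M) hr₀ h2M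
    τ₀ R₀ hρ₁ hρt₂ hsρ (contDiff_one_radialCutoff_real t₂ s₂) (radialCutoff_real_of_abs_le ht₂0 hts)
    (radialCutoff_real_of_le_abs ht₂0 hts)
  -- the inner constant
  set Kin : ℝ := Real.sqrt (2 * M / r₀ - 1) *
    (|(M - r₀) / (2 * r₀ ^ 2 * Real.sqrt (2 * M / r₀ - 1))| * 4 + 4) *
      ∫ y : E3, |deriv (fun x ↦ 1 - radialCutoff s₁ t₁ x) ‖y‖| with hKin
  have hKin0 : 0 ≤ Kin := by
    have hI : 0 ≤ ∫ y : E3, |deriv (fun x ↦ 1 - radialCutoff s₁ t₁ x) ‖y‖| :=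
      integral_nonneg fun y ↦ abs_nonneg _
    positivity
  refine ⟨min δC δG, Kin, C, by positivity, hKin0, hC, fun ε D hD ↦ ?_⟩
  obtain ⟨hinI, hinB⟩ := abs_innerTerm_time_le hr₁ hr₀ h2M hρ₁ hρs hst htρ τ₀ R₀ hD
  refine ⟨∫ y, timeIntegrandWith M r₀ (fun x ↦ 1 - radialCutoff s₁ t₁ x)
      (D.coordH y - cylH M 0 r₀ τ₀ R₀ y) (D.coordK y - cylK M 0 hr₀ τ₀ R₀ y) y,
    by rw [hKin]; exact hinB, ?_⟩
  refine ⟨fun p ↦ (∫ y, timeIntegrandWith M r₀ (radialCutoff t₂ s₂)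
      (cylH (M + p.1) ‖p.2‖ r₀ τ₀ (spinIsometry p.2) y - cylH M 0 r₀ τ₀ R₀ y)
      (cylK (M + p.1) ‖p.2‖ hr₀ τ₀ (spinIsometry p.2) y - cylK M 0 hr₀ τ₀ R₀ y) y) - 8 * π * p.1,
    ?_, ?_, ?_⟩
  · -- continuity of `q₀`
    refine (hcont.mono fun p (hp : |p.1| + ‖p.2‖ < min δC δG) ↦
      show |p.1| + ‖p.2‖ < δG from lt_of_lt_of_le hp (min_le_right _ _)).sub ?_
    exact (continuous_const.mul continuous_fst).continuousOn
  · -- the `O(|p|²)` bound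
    intro p hp
    exact (hout p ((le_of_lt hp).trans (min_le_left _ _))).2
  · -- the identity
    intro p hp ha h₁ h₂ γ₁ κ₁ hγ₁ hκ₁ hγ₁s hκ₁s hplat
    obtain ⟨hχE, hχ, h0in, h0out⟩ := shellProfile_hypotheses hs₁1 hst ht₁₂ hts
    set D' := preGluedDatum ha h₁ h₂ τ₀ (spinIsometry p.2) c₁ c₂ D with hD'
    obtain ⟨hγ, hγs, hκ, hκs⟩ := variation_hypotheses hr₀ h2M τ₀ R₀ D'
    have hγ' : ContDiffOn ℝ ∞ (fun z ↦ D'.coordH z - cylH M 0 r₀ τ₀ R₀ z + γ₁ z) {y : E3 | 1 < ‖y‖} :=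
      hγ.add hγ₁
    have hκ' : ContDiffOn ℝ ∞ (fun z ↦ D'.coordK z - cylK M 0 hr₀ τ₀ R₀ z + κ₁ z) {y : E3 | 1 < ‖y‖} :=
      hκ.add hκ₁
    have hγs' : ∀ y ∈ {y : E3 | 1 < ‖y‖}, ∀ v w,
        (D'.coordH y - cylH M 0 r₀ τ₀ R₀ y + γ₁ y) v w = (D'.coordH y - cylH M 0 r₀ τ₀ R₀ y + γ₁ y) w v := by
      intro y hy v w
      rw [add_apply, add_apply, add_apply, add_apply, hγs y hy v w, hγ₁s y v w]
    have hκs' : ∀ y ∈ {y : E3 | 1 < ‖y‖}, ∀ v w,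
        (D'.coordK y - cylK M 0 hr₀ τ₀ R₀ y + κ₁ y) v w = (D'.coordK y - cylK M 0 hr₀ τ₀ R₀ y + κ₁ y) w v := by
      intro y hy v w
      rw [add_apply, add_apply, add_apply, add_apply, hκs y hy v w, hκ₁s y v w]
    rw [integral_linMomFn_cutoff_dirVec_eq hr₀ h2M τ₀ R₀ hs₁1 hχE hχ h0in h0out hγ' hγs' hκ' hκs']
    -- pointwise: drop the plateau correction, then split the two layers
    have hsplit : ∀ y : E3, timeIntegrandWith M r₀ (shellProfile s₁ t₁ t₂ s₂)
        (D'.coordH y - cylH M 0 r₀ τ₀ R₀ y + γ₁ y) (D'.coordK y - cylK M 0 hr₀ τ₀ R₀ y + κ₁ y) y =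
        timeIntegrandWith M r₀ (fun x ↦ 1 - radialCutoff s₁ t₁ x)
            (D.coordH y - cylH M 0 r₀ τ₀ R₀ y) (D.coordK y - cylK M 0 hr₀ τ₀ R₀ y) y +
          timeIntegrandWith M r₀ (radialCutoff t₂ s₂)
            (cylH (M + p.1) ‖p.2‖ r₀ τ₀ (spinIsometry p.2) y - cylH M 0 r₀ τ₀ R₀ y)
            (cylK (M + p.1) ‖p.2‖ hr₀ τ₀ (spinIsometry p.2) y - cylK M 0 hr₀ τ₀ R₀ y) y := by
      intro y
      rw [timeIntegrandWith_add_of_plateau M r₀ _ _ _ _ _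
          (fun hd ↦ hplat y (norm_le_or_le_of_deriv_shellProfile_ne_zero hs₁0 hst ht₁₂ hts hd)),
        timeIntegrandWith_shellProfile M r₀ hs₁0 hst ht₁₂ hts]
      congr 1
      · by_cases hd : deriv (fun x ↦ 1 - radialCutoff s₁ t₁ x) ‖y‖ = 0
        · rw [timeIntegrandWith_eq_zero M r₀ _ _ hd, timeIntegrandWith_eq_zero M r₀ _ _ hd]
        · have hy : ‖y‖ ≤ c₁ := by
            have h := (deriv_inner_support hs₁0 hst ‖y‖ hd).2
            rw [abs_norm] at h
            exact h.trans htc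
          rw [hD', coordH_preGluedDatum_of_norm_le ha h₁ h₂ τ₀ _ hc₁0 hc D hy,
            coordK_preGluedDatum_of_norm_le ha h₁ h₂ τ₀ _ hc₁0 hc D hy]
      · by_cases hd : deriv (radialCutoff t₂ s₂) ‖y‖ = 0
        · rw [timeIntegrandWith_eq_zero M r₀ _ _ hd, timeIntegrandWith_eq_zero M r₀ _ _ hd]
        · have hy : c₂ ≤ ‖y‖ := by
            have h := (deriv_cutoffProfile_support (radialCutoff_real_of_abs_le ht₂0 hts)
              (radialCutoff_real_of_le_abs ht₂0 hts) ‖y‖ hd).1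
            rw [abs_norm] at h
            exact hct.trans h
          rw [hD', coordH_preGluedDatum_of_le_norm ha h₁ h₂ τ₀ _ hc₁0 hc D hy,
            coordK_preGluedDatum_of_le_norm ha h₁ h₂ τ₀ _ hc₁0 hc D hy]
    simp_rw [hsplit]
    obtain ⟨houtI, -⟩ := hout p ((le_of_lt hp).trans (min_le_left _ _))
    rw [integral_add hinI houtI]
    ring

/-! ### The `Ω_ξ`-components -/

/-- **The linear part of the `Ω_ξ`-obstruction, packaged for the degree step** (`‖ξ‖ ≤ 1`):
with the same data, `∫ √g₀ χ DM(D̃(p) + (h, ω) − (G₀, K₀))(Ω_ξ) dy = −8πM⟨b, ξ⟩ + e_ξ + q_ξ p`,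
`|e_ξ| ≤ C₁ε`, `q_ξ` continuous with `|q_ξ p| ≤ C₂(|p.1| + ‖p.2‖)²` on the box.
[cite: LiMei2020, proof of Prop. 4.1, p. 25] -/
theorem exists_linearObstruction_rot_package {M r₁ r₀ ρ₁ ρ₂ s₁ t₁ c₁ c₂ t₂ s₂ : ℝ} {k : ℕ}
    (hr₁ : r₁ < r₀) (hr₀ : 0 < r₀) (h2M : r₀ < 2 * M) (hρ₁ : 1 ≤ ρ₁) (hρs : ρ₁ < s₁) (hst : s₁ < t₁)
    (htc : t₁ ≤ c₁) (hc : c₁ < c₂) (hct : c₂ ≤ t₂) (hts : t₂ < s₂) (hsρ : s₂ < ρ₂) (τ₀ : ℝ)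
    (R₀ : E3 →ₗᵢ[ℝ] E3) :
    ∃ δ C₁ C₂ : ℝ, 0 < δ ∧ 0 ≤ C₁ ∧ 0 ≤ C₂ ∧ ∀ (ε : ℝ) (D : InitialDataSet (𝓡 3) E3),
      NearSchwarzschildCylinder M r₁ r₀ ρ₁ ρ₂ k ε D → ∀ ξ : E3, ‖ξ‖ ≤ 1 →
      ∃ e₁ : ℝ, |e₁| ≤ C₁ * ε ∧ ∃ q₁ : ℝ × E3 → ℝ,
        ContinuousOn q₁ {p : ℝ × E3 | |p.1| + ‖p.2‖ < δ} ∧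
        (∀ p : ℝ × E3, |p.1| + ‖p.2‖ < δ → |q₁ p| ≤ C₂ * (|p.1| + ‖p.2‖) ^ 2) ∧
        ∀ p : ℝ × E3, |p.1| + ‖p.2‖ < δ →
          ∀ (ha : |‖p.2‖| < M + p.1) (h₁ : Kerr.rMinus (M + p.1) ‖p.2‖ < r₀)
            (h₂ : r₀ < Kerr.rPlus (M + p.1) ‖p.2‖) (γ₁ κ₁ : E3 → E3 →L[ℝ] E3 →L[ℝ] ℝ),
            ContDiffOn ℝ ∞ γ₁ {y : E3 | 1 < ‖y‖} → ContDiffOn ℝ ∞ κ₁ {y : E3 | 1 < ‖y‖} →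
            (∀ y v w, γ₁ y v w = γ₁ y w v) → (∀ y v w, κ₁ y v w = κ₁ y w v) →
            (∀ y : E3, (‖y‖ ≤ t₁ ∨ t₂ ≤ ‖y‖) → γ₁ y = 0 ∧ κ₁ y = 0) →
            ∫ y, sqrtDetGram (cylH M 0 r₀ τ₀ R₀) (EuclideanSpace.basisFun (Fin 3) ℝ).toBasis y *
                (shellProfile s₁ t₁ t₂ s₂ ‖y‖ *
                  linMomFn (EuclideanSpace.basisFun (Fin 3) ℝ).toBasis (cylH M 0 r₀ τ₀ R₀)
                    (cylK M 0 hr₀ τ₀ R₀)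
                    (fun z ↦ (preGluedDatum ha h₁ h₂ τ₀ (spinIsometry p.2) c₁ c₂ D).coordH z -
                      cylH M 0 r₀ τ₀ R₀ z + γ₁ z)
                    (fun z ↦ (preGluedDatum ha h₁ h₂ τ₀ (spinIsometry p.2) c₁ c₂ D).coordK z -
                      cylK M 0 hr₀ τ₀ R₀ z + κ₁ z) y (crossCLM ξ y)) =
              -(8 * π * M) * ⟪p.2, ξ⟫ + e₁ + q₁ p := by
  have hρt₂ : ρ₁ < t₂ := by linarith
  have htρ : t₁ < ρ₂ := by linarith
  have hs₁1 : 1 < s₁ := lt_of_le_of_lt hρ₁ hρs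
  have hs₁0 : 0 ≤ s₁ := zero_le_one.trans hs₁1.le
  have ht₂0 : 0 ≤ t₂ := by linarith
  have hc₁0 : 0 ≤ c₁ := by linarith
  have ht₁₂ : t₁ ≤ t₂ := htc.trans (hc.le.trans hct)
  obtain ⟨δC, C, hδC, hC, hout⟩ := exists_abs_integral_rotIntegrandWith_sub_le hr₀ h2M τ₀ R₀ hρ₁
    hρt₂ hsρ (contDiff_one_radialCutoff_real t₂ s₂) (radialCutoff_real_of_abs_le ht₂0 hts)
    (radialCutoff_real_of_le_abs ht₂0 hts)
  obtain ⟨δG, hδG, hcont⟩ := exists_continuousOn_integral_rotIntegrandWith_family (M := M) hr₀ h2M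
    τ₀ R₀ hρ₁ hρt₂ hsρ (contDiff_one_radialCutoff_real t₂ s₂) (radialCutoff_real_of_abs_le ht₂0 hts)
    (radialCutoff_real_of_le_abs ht₂0 hts)
  set Kin : ℝ := (r₀ + r₀ ^ 2 / Real.sqrt (2 * M / r₀ - 1)) *
      ∫ y : E3, |deriv (fun x ↦ 1 - radialCutoff s₁ t₁ x) ‖y‖| with hKin
  have hsA : 0 < Real.sqrt (2 * M / r₀ - 1) := Real.sqrt_pos.2 (lapse_pos hr₀ h2M)
  have hKin0 : 0 ≤ Kin := by
    have hI : 0 ≤ ∫ y : E3, |deriv (fun x ↦ 1 - radialCutoff s₁ t₁ x) ‖y‖| :=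
      integral_nonneg fun y ↦ abs_nonneg _
    positivity
  refine ⟨min δC δG, Kin, C, by positivity, hKin0, hC, fun ε D hD ξ hξ ↦ ?_⟩
  obtain ⟨hinI, hinB⟩ := abs_innerTerm_rot_le hr₁ hr₀ h2M hρ₁ hρs hst htρ τ₀ R₀ hD hξ
  refine ⟨∫ y, rotIntegrandWith M r₀ (fun x ↦ 1 - radialCutoff s₁ t₁ x) ξ
      (D.coordH y - cylH M 0 r₀ τ₀ R₀ y) (D.coordK y - cylK M 0 hr₀ τ₀ R₀ y) y,
    by rw [hKin]; exact hinB, ?_⟩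
  refine ⟨fun p ↦ (∫ y, rotIntegrandWith M r₀ (radialCutoff t₂ s₂) ξ
      (cylH (M + p.1) ‖p.2‖ r₀ τ₀ (spinIsometry p.2) y - cylH M 0 r₀ τ₀ R₀ y)
      (cylK (M + p.1) ‖p.2‖ hr₀ τ₀ (spinIsometry p.2) y - cylK M 0 hr₀ τ₀ R₀ y) y) +
      8 * π * M * ⟪p.2, ξ⟫, ?_, ?_, ?_⟩
  · refine ((hcont ξ hξ).mono fun p (hp : |p.1| + ‖p.2‖ < min δC δG) ↦
      show |p.1| + ‖p.2‖ < δG from lt_of_lt_of_le hp (min_le_right _ _)).add ?_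
    exact (continuous_const.mul (continuous_snd.inner continuous_const)).continuousOn
  · intro p hp
    exact (hout p ((le_of_lt hp).trans (min_le_left _ _)) ξ hξ).2
  · intro p hp ha h₁ h₂ γ₁ κ₁ hγ₁ hκ₁ hγ₁s hκ₁s hplat
    obtain ⟨hχE, hχ, h0in, h0out⟩ := shellProfile_hypotheses hs₁1 hst ht₁₂ hts
    set D' := preGluedDatum ha h₁ h₂ τ₀ (spinIsometry p.2) c₁ c₂ D with hD'
    obtain ⟨hγ, hγs, hκ, hκs⟩ := variation_hypotheses hr₀ h2M τ₀ R₀ D'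
    have hγ' : ContDiffOn ℝ ∞ (fun z ↦ D'.coordH z - cylH M 0 r₀ τ₀ R₀ z + γ₁ z) {y : E3 | 1 < ‖y‖} :=
      hγ.add hγ₁
    have hκ' : ContDiffOn ℝ ∞ (fun z ↦ D'.coordK z - cylK M 0 hr₀ τ₀ R₀ z + κ₁ z) {y : E3 | 1 < ‖y‖} :=
      hκ.add hκ₁
    have hγs' : ∀ y ∈ {y : E3 | 1 < ‖y‖}, ∀ v w,
        (D'.coordH y - cylH M 0 r₀ τ₀ R₀ y + γ₁ y) v w = (D'.coordH y - cylH M 0 r₀ τ₀ R₀ y + γ₁ y) w v := by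
      intro y hy v w
      rw [add_apply, add_apply, add_apply, add_apply, hγs y hy v w, hγ₁s y v w]
    have hκs' : ∀ y ∈ {y : E3 | 1 < ‖y‖}, ∀ v w,
        (D'.coordK y - cylK M 0 hr₀ τ₀ R₀ y + κ₁ y) v w = (D'.coordK y - cylK M 0 hr₀ τ₀ R₀ y + κ₁ y) w v := by
      intro y hy v w
      rw [add_apply, add_apply, add_apply, add_apply, hκs y hy v w, hκ₁s y v w]
    rw [integral_linMomFn_cutoff_crossCLM_eq hr₀ h2M τ₀ R₀ ξ hs₁1 hχE hχ h0in h0out hγ' hγs' hκ' hκs']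
    have hsplit : ∀ y : E3, rotIntegrandWith M r₀ (shellProfile s₁ t₁ t₂ s₂) ξ
        (D'.coordH y - cylH M 0 r₀ τ₀ R₀ y + γ₁ y) (D'.coordK y - cylK M 0 hr₀ τ₀ R₀ y + κ₁ y) y =
        rotIntegrandWith M r₀ (fun x ↦ 1 - radialCutoff s₁ t₁ x) ξ
            (D.coordH y - cylH M 0 r₀ τ₀ R₀ y) (D.coordK y - cylK M 0 hr₀ τ₀ R₀ y) y +
          rotIntegrandWith M r₀ (radialCutoff t₂ s₂) ξ
            (cylH (M + p.1) ‖p.2‖ r₀ τ₀ (spinIsometry p.2) y - cylH M 0 r₀ τ₀ R₀ y)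
            (cylK (M + p.1) ‖p.2‖ hr₀ τ₀ (spinIsometry p.2) y - cylK M 0 hr₀ τ₀ R₀ y) y := by
      intro y
      rw [rotIntegrandWith_add_of_plateau M r₀ _ ξ _ _ _ _
          (fun hd ↦ hplat y (norm_le_or_le_of_deriv_shellProfile_ne_zero hs₁0 hst ht₁₂ hts hd)),
        rotIntegrandWith_shellProfile M r₀ hs₁0 hst ht₁₂ hts]
      congr 1
      · by_cases hd : deriv (fun x ↦ 1 - radialCutoff s₁ t₁ x) ‖y‖ = 0
        · rw [rotIntegrandWith_eq_zero M r₀ ξ _ _ hd, rotIntegrandWith_eq_zero M r₀ ξ _ _ hd]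
        · have hy : ‖y‖ ≤ c₁ := by
            have h := (deriv_inner_support hs₁0 hst ‖y‖ hd).2
            rw [abs_norm] at h
            exact h.trans htc
          rw [hD', coordH_preGluedDatum_of_norm_le ha h₁ h₂ τ₀ _ hc₁0 hc D hy,
            coordK_preGluedDatum_of_norm_le ha h₁ h₂ τ₀ _ hc₁0 hc D hy]
      · by_cases hd : deriv (radialCutoff t₂ s₂) ‖y‖ = 0
        · rw [rotIntegrandWith_eq_zero M r₀ ξ _ _ hd, rotIntegrandWith_eq_zero M r₀ ξ _ _ hd]
        · have hy : c₂ ≤ ‖y‖ := by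
            have h := (deriv_cutoffProfile_support (radialCutoff_real_of_abs_le ht₂0 hts)
              (radialCutoff_real_of_le_abs ht₂0 hts) ‖y‖ hd).1
            rw [abs_norm] at h
            exact hct.trans h
          rw [hD', coordH_preGluedDatum_of_le_norm ha h₁ h₂ τ₀ _ hc₁0 hc D hy,
            coordK_preGluedDatum_of_le_norm ha h₁ h₂ τ₀ _ hc₁0 hc D hy]
    simp_rw [hsplit]
    obtain ⟨houtI, -⟩ := hout p ((le_of_lt hp).trans (min_le_left _ _)) ξ hξ
    rw [integral_add hinI houtI]
    ring

end Package

end LiMei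

end Literature.Geometry.Lorentzian

end
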